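import Mathlib
import Summits.QuantumFields.QCD.Theorems.PauliWegnerSeaPhaseQuenchedFlavourDecayConstRegularisation
import Summits.QuantumFields.QCD.Theorems.PauliWegnerSeaPhaseQuenchedFlavourDecayDoubletMinorSecondMoment

/-!
# Stub `stub_doubletMinorSecondMomentAt_of_crux` of line `crossing-split-integrability`
(crux `Summit.QuantumFields.QCD.Theses.PauliWegnerSea.PhaseQuenchedFlavourDecay`, item stmt-QuantumFields-9151)

**Fixed-point RANK-`r` NECESSITY.** At every constant lattice parameter point `(β, c, λ)`, `λ > 0`, with a
mass-degenerate doublet `m_f = m_g`, `f ≠ g`, plain exponential fractional-moment decay of the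
phase-quenched propagator on all large volumes forces, for every rank `r ≥ 1`, every quark box `R` and all
site tuples `x y : Fin r → box R`, exponential decay at some lattice rate `μ' > 0`, uniformly in `S ≥ S₀`,
`n ≤ S`, of the colour–spin summed phase-quenched SECOND MOMENT of the `r × r` Wick minors
`⟨Σ_{P,Q} |det[G_f((x_a,P_a),(y_b + n e₀,Q_b))]|²⟩₊ ≤ C' e^{-μ' n}` — the rank-`r` twin of
`stub_pionSecondMomentAt_of_crux` (p134237) and the refuter's sharpest single-point target at rank `r`
("FM-localised propagator but a non-clustering / volume-divergent rank-`r` doublet minor second moment").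

Pure composition of landed bookkeeping: the point is realised by a constant-parameter regularisation
(`stub_existsConstRegularisation`), along which the fixed-point hypothesis is the crux's UPPER
(`stub_upperConstIff`, direction `←`); `stub_doubletMinorSecondMoment_of_crux` (p152271) gives the
eventual-in-`k` bound at rate `δ' a_k` on volumes `≥ L_k`; evaluating at one late `k` (rate `μ' = δ' a_k > 0`,
threshold `S₀ = L_k`) and rewriting the constant parameters gives the claim.
-/

noncomputable section

namespace Summit.QuantumFields.QCD.Cruxes.PhaseQuenchedFlavourDecay.CrossingSplitIntegrability

open scoped BigOperators
open MeasureTheory Filter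
open Literature.MathematicalPhysics.QuantumFieldTheory Literature.MathematicalPhysics.QuantumLattice
  Literature.Probability.LatticeModels

/-- At a constant-parameter regularisation the bare mass tuple is the constant tuple `c + λ m`. -/
private theorem mq_const_eq_r {Nf : ℕ} (reg : QCDRegularisation Nf) (m : Fin Nf → ℝ) (c lam : ℝ)
    (h2 : ∀ k, reg.mcrit k = c) (h3 : ∀ k, reg.a k / reg.Zm k = lam) (k : ℕ) :
    (fun fl => reg.mcrit k + reg.a k * m fl / reg.Zm k) = fun fl => c + lam * m fl := by
  funext fl
  rw [h2 k, mul_div_right_comm, h3 k]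

/-- Abstract one-step evaluation: for a `k`-independent family of quantities `Φk k = Φ`, an
eventual-in-`k` bound at rate `δ' a_k` on volumes `≥ L_k` yields, at one late `k`, a bound at the
fixed rate `μ' = δ' a_k > 0` on all volumes `≥ S₀ = L_k`. -/
private theorem atPoint_core_r {Nf : ℕ} (reg : QCDRegularisation Nf)
    (Φk : ℕ → ℕ → ℕ → ℝ) (Φ : ℕ → ℕ → ℝ) {δ' C' : ℝ} (hδ' : 0 < δ')
    (hev : ∀ᶠ k in atTop, ∀ S : ℕ, reg.L k ≤ S → ∀ n : ℕ, n ≤ S →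
      Φk k S n ≤ C' * Real.exp (-(δ' * (reg.a k * n))))
    (hΦ : ∀ k S n, Φk k S n = Φ S n) :
    ∃ C' μ' : ℝ, 0 < μ' ∧ ∃ S₀ : ℕ, ∀ S : ℕ, S₀ ≤ S → ∀ n : ℕ, n ≤ S →
      Φ S n ≤ C' * Real.exp (-(μ' * n)) := by
  obtain ⟨k, hk⟩ := hev.exists
  refine ⟨C', δ' * reg.a k, mul_pos hδ' (reg.a_pos k), reg.L k, fun S hS n hn => ?_⟩
  calc Φ S n = Φk k S n := (hΦ k S n).symm
    _ ≤ C' * Real.exp (-(δ' * (reg.a k * n))) := hk S hS n hn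
    _ = C' * Real.exp (-(δ' * reg.a k * n)) := by rw [mul_assoc]

/-- W11b: fixed-point RANK-r NECESSITY — at every lattice parameter point with a mass-degenerate doublet, FM exponential decay of the PQ propagator forces exponential decay of the PQ second moments of all r × r doublet Wick minors along e₀, uniformly in large volumes. -/
theorem stub_doubletMinorSecondMomentAt_of_crux :
    Summit.QuantumFields.QCD.Theses.PauliWegnerSea.PhaseQuenchedFlavourDecay → ∀ (Nf : ℕ) (m : Fin Nf → ℝ), (∀ f, 0 < m f) → ∀ (f g : Fin Nf), f ≠ g → m f = m g → ∀ (β c lam : ℝ), 0 < lam → (∃ s C μ : ℝ, 0 < s ∧ s < 1 ∧ 0 < μ ∧ ∃ S₀ : ℕ, ∀ S : ℕ, S₀ ≤ S → ∀ (f : Fin Nf) (v : Literature.Probability.LatticeModels.Site 4), v ∈ box 4 S → (∫ U : GaugeConfig 4 (2 * S + 1) (Matrix.specialUnitaryGroup (Fin 3) ℂ), ‖(diracMatrix U fun fl => c + lam * m fl).det‖ * (∑ a : Fin 3, ∑ i : Fin 4, ∑ b : Fin 3, ∑ j : Fin 4, ‖(diracMatrix U fun fl => c + lam * m fl)⁻¹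 (quarkEquiv (f, (Torus.proj (2 * S + 1) 0, a, i))) (quarkEquiv (f, (Torus.proj (2 * S + 1) (v), b, j)))‖) ^ s ∂(wilsonMeasure (fundamentalRep (Fin 3)) β)) / (∫ U : GaugeConfig 4 (2 * S + 1) (Matrix.specialUnitaryGroup (Fin 3) ℂ), ‖(diracMatrix U fun fl => c + lam * m fl).det‖ ∂(wilsonMeasure (fundamentalRep (Fin 3)) β)) ≤ C * Real.exp (-(μ * ‖v‖))) → ∀ (r R : ℕ), 0 < r → ∀ (x y : Fin r → ↥(box 4 R)), ∃ C' μ' : ℝ, 0 < μ' ∧ ∃ S₀ : ℕ, ∀ S : ℕ, S₀ ≤ S → ∀ n : ℕ, n ≤ S → qcdPhaseQuenchedExpect β (2 * S + 1) (fun fl => c + lam * m fl) (fun U : GaugeConfig 4 (2 * S + 1) SU3 => ∑ P : Fin r → Fin 3 × Fin 4, ∑ Q : Fin r → Fin 3 × Fin 4, ‖(Matrix.of fun a b : Fin r => (diracMatrix U fun fl => c + lam * m fl)⁻¹ (quarkEquiv (f, (Torus.proj (2 * S + 1) (x a : Literature.Probability.LatticeModels.Site 4), (P a).1, (P a).2)))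 (quarkEquiv (f, (Torus.proj (2 * S + 1) ((y b : Literature.Probability.LatticeModels.Site 4) + Pi.single 0 (n : ℤ)), (Q b).1, (Q b).2)))).det‖ ^ (2 : ℕ)) ≤ C' * Real.exp (-(μ' * n)) := by
  intro hcrux Nf m hm f g hfg hmfg β c lam hlam hF r R hr x y
  obtain ⟨reg, h1, h2, h3⟩ := stub_existsConstRegularisation Nf β c lam hlam
  have hU := (stub_upperConstIff Nf reg m β c lam h1 h2 h3).2 hF
  obtain ⟨δ', hδ', hall⟩ := stub_doubletMinorSecondMoment_of_crux hcrux Nf reg m hm f g hfg hmfg hU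
  obtain ⟨C', hev⟩ := hall r R hr x y
  refine atPoint_core_r reg _ _ hδ' hev fun k S n => ?_
  rw [h1 k, mq_const_eq_r reg m c lam h2 h3 k]

end Summit.QuantumFields.QCD.Cruxes.PhaseQuenchedFlavourDecay.CrossingSplitIntegrability
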